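import Summits.QuantumFields.BalabanUV.Beta.SymShiftedSpread
import Summits.QuantumFields.BalabanUV.Beta.RelInvNullShift

/-!
# `BalabanUV.Beta.RelInvFactorSandwich` — binder row D1, RULING R-D1-g28-2 (F)+(S): THE RELATIVE-INVERSE SANDWICH OF A DIAGONAL COMMUTATOR CONTACT
# ON THE MULTIPLIER BLOCK **WITHOUT A COMMUTATION HYPOTHESIS** — `mm(K ∘ conjV M (diagK g) ∘ K) = mm(−conjV K (diagK g))` from the BLOCK FACTS
# `(M∘K)_fm = 0`, `(K∘M)_mf = 0`, `(M∘K)_mm = (K∘M)_mm = 1_coarse` — and the instances for the (0.4) literal's symmetrised step resolvents `Gsym j`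
# against the straight spread `bhKStep j` (the tree's factorisation `bhKStep j ∘ G_j = Π̂ᵀ_sym,C`) and against the SHIFTED spread `bhKStepSh Dsh j`
# (from (Dspr)(Dnull) and the new letter (DG) «the shift's border is invisible to the multiplier block of `G_j`»)

HONEST FRAMING (cell charter, verbatim): «discharging BetaPertH makes Balaban's UV stability UNCONDITIONAL — a real constructive-QFT result; it is
NOT the continuum limit and NOT the Clay problem.»  HONEST DEPENDENCY: continuum YM on T⁴ ⇐ BetaPertH ∧ nine spine estimates (0/9 proved); BetaPertH
⇐ (D1) ∧ (D4) ∧ CAP+tail; G-an2-4 gates asym, D1 and NE2/3/4.  DERIVED cell leaf (β sub-cell, BINDER-OWNERS row D1 OWNER `b2b-balaban-beta-an2`, gen 28; file E1 of the build order of RULING R-D1-g28-2).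
WHY.  The comb's (Sr-conj) induction evaluates the cubic sector's contact through an3's `E3CoDressedContact.sandwich_conjV_smul_diagK` =
`RelInvSandwich.sandwich_conjV_rel`, which needs `[E, diagK g] = 0` — automatic for the DIAGONAL axial projector `axEc`, false for the symmetrised
slice projector `symEc` (block projector `Pmat`; an3-g55's located remark (R-i)).  What the induction actually consumes is only the MULTIPLIER block
of the sandwich (it is read by `mmRead`), and that block needs no commutation: if `(M∘K)_fm = 0` and `(K∘M)_mf = 0` and the two `mm` blocks are the
coarse indicator, then for every localised diagonal `X = diagK g`, `mm(K∘M∘X∘K) = X_mm K_mm`, `mm(K∘X∘M∘K) = K_mm X_mm`, so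
`mm(K∘[M,X]∘K) = −[K_mm, X_mm] = mm(−conjV K X)` — §2 `mm_sandwich_conjV_diagK`.  For the literal these block facts are IN THE TREE: for every `j`,
`bhKStep d Lc j ∘ G_j = piKSymBmC ρ_c Lc` and `G_j ∘ bhKStep d Lc j = trK piKSymBmC` (`RelInvSymBorderedHessianStep.comp_bhKStep_coDressKSymAt` ∕
`comp_coDressKSymAt_bhKStep`, `j = 0`: `RelInvSymBorderedHessian.comp_bhK_coDressKSymAt_KInv` ∕ `comp_coDressKSymAt_KInv_bhK`) with
`piKSymBmC_inl_inr = piKSymBmC_inr_inl = 0`, `piKSymBmC_inr_inr` = coarse indicator (`SymSliceProjectorRules`) — §3; for the SHIFTED spread of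
R-D1-g28-1, `bhKStepSh d Lc Dsh j = bhKStep j + stepScale j • Dsh`, the `mm` blocks stay the coarse indicator by (Dnull) `symEc∘Dsh∘symEc = 0` and
rules 1–2 (`symEc∘G_j = G_j = G_j∘symEc`), and the `fm`∕`mf` blocks vanish by the displayed letter (DG) `(G_j∘Dsh)_mf = 0 ∧ (Dsh∘G_j)_fm = 0` — §4.
HONEST: [folklore] kernel algebra over OUR objects; (DG) is a HYPOTHESIS here (it follows from «`Dsh_mf` is a finitely supported coarse-gradient readout»
+ `ValueHessianGauge.tsum_E2_mul_grad_eq_zero`, to be filed); discharges NOTHING of the row: root-level classes 0∕5; tables 0∕5; NOT D1, NOT `BetaPertH`,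
NOT continuum, NOT Clay.  No statement of Bałaban's papers, no `[cite:]`, no `Prop` fact, no `def`.
WHAT ([folklore]): §1 entry tools (`comp_apply'`, `comp_row_eq_zero`, `comp_col_eq_zero`, the coarse point-mass rows∕columns of `symEc`:
`symEc_comp_inr_row`, `comp_symEc_inr_col`, and the coarse support of a kernel fixed by `symEc`: `inr_row_coarse`, `inr_col_coarse`); §2
**`mm_sandwich_conjV_diagK`**; §3 `comp_bhKStep_Gsym` ∕ `comp_Gsym_bhKStep` (every `j`) with their blocks, `spr_Gsym`, `Gsym_inr_row_coarse` ∕ `_col_coarse`,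
**`mm_sandwich_Gsym_bhKStep`**; §4 the shifted spread: `comp_Dsh_Gsym_inr_of_null`, `comp_Gsym_Dsh_inr_of_null`, the four blocks of `bhKStepSh Dsh j ∘ G_j` and
`G_j ∘ bhKStepSh Dsh j`, **`mm_sandwich_Gsym_bhKStepSh`**.  Provenance: β sub-cell, unit beta-an2 gen 28, 2026-08-21 (v1); over the files named above BY NAME; no existing file touched.
-/

noncomputable section

open Finset
open scoped BigOperators
open Literature.Probability.LatticeModels (Torus.proj)
open Literature.MathematicalPhysics.QuantumFieldTheory
open Literature.MathematicalPhysics.QuantumFieldTheory.Balaban1983to89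
open Literature.MathematicalPhysics.QuantumFieldTheory.Balaban1983to89.Beta
open ExpKernelCalculus (MKer comp)
open OneStepResolventKernel (Fib)
open OneStepKernelFamily (KInvStep)
open AveragingContoursRooted (ctr ctrOff ctrOff_mem_box)
open Summit.QuantumFields.BalabanUV.Beta.TameKernelCalculus
open Summit.QuantumFields.BalabanUV.Beta.ChartConjugation (conjV)
open Summit.QuantumFields.BalabanUV.Beta.ChartConjugationRelative (spr_comp)
open Summit.QuantumFields.BalabanUV.Beta.AxialDressingRooted (one_le_of_neZero tsum_point tsum_point')
open Summit.QuantumFields.BalabanUV.Beta.BorderedHessian (bhK bhKStep bhKStep_zero spr_bhKStep stepScale diagK conjV_diagK_apply comp_diagK_right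
  KInvStep_zero_eq)
open Summit.QuantumFields.BalabanUV.Beta.SymmetrisedDressingKernel (coDressKSymAt)
open Summit.QuantumFields.BalabanUV.Beta.SymSliceProjectorKernel (symEc symEc_inr_inr symEc_inr_inl symEc_inl_inr)
open Summit.QuantumFields.BalabanUV.Beta.SymSliceProjectorSpread (spr_symEc)
open Summit.QuantumFields.BalabanUV.Beta.SymSliceProjectorRules (piKSymBmC piKSymBmC_inl_inr piKSymBmC_inr_inl piKSymBmC_inr_inr)
open Summit.QuantumFields.BalabanUV.Beta.RelInvSymBorderedHessian (comp_bhK_coDressKSymAt_KInv comp_coDressKSymAt_KInv_bhK)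
open Summit.QuantumFields.BalabanUV.Beta.RelInvSymBorderedHessianStep (comp_bhKStep_coDressKSymAt comp_coDressKSymAt_bhKStep
  symEc_rules_coDressKSymAt_KInvStep)
open Summit.QuantumFields.BalabanUV.Beta.SymmetrisedStepJets (Gsym Gsym_apply decays_Gsym)
open Summit.QuantumFields.BalabanUV.Beta.SymShiftedSpread (bhKStepSh bhKStepSh_apply spr_bhKStepSh)
open Summit.QuantumFields.BalabanUV.Beta.RelInvNullShift (spr_smul)

namespace Summit.QuantumFields.BalabanUV.Beta.RelInvFactorSandwich

variable {d : ℕ}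

/-! ## §1 Entry tools -/

section Tools

variable {N : ℕ}

/-- [folklore] The composition formula, one entry. -/
theorem comp_apply' (A B : MKer (d + 1) (Fib d)) (x z : Fin (d + 1) → ℤ) (a b : Fib d) :
    comp A B x z a b = ∑' y, ∑ f, A x y a f * B y z f b := rfl

/-- [folklore] A composition entry vanishes when the left factor's row vanishes. -/
theorem comp_row_eq_zero {A B : MKer (d + 1) (Fib d)} {x : Fin (d + 1) → ℤ} {a : Fib d} (h : ∀ y f, A x y a f = 0)
    (z : Fin (d + 1) → ℤ) (b : Fib d) : comp A B x z a b = 0 := by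
  rw [comp_apply']
  exact (tsum_congr fun y => Finset.sum_eq_zero fun f _ => by rw [h y f, zero_mul]).trans tsum_zero

/-- [folklore] A composition entry vanishes when the right factor's column vanishes. -/
theorem comp_col_eq_zero {A B : MKer (d + 1) (Fib d)} {z : Fin (d + 1) → ℤ} {b : Fib d} (h : ∀ y f, B y z f b = 0)
    (x : Fin (d + 1) → ℤ) (a : Fib d) : comp A B x z a b = 0 := by
  rw [comp_apply']
  exact (tsum_congr fun y => Finset.sum_eq_zero fun f _ => by rw [h y f, mul_zero]).trans tsum_zero

/-- [folklore] **THE MULTIPLIER ROWS OF `symEc` ARE COARSE POINT MASSES**: `(symEc N ∘ A) x y (inr m) f = [proj N x = 0] · A x y (inr m) f`. -/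
theorem symEc_comp_inr_row (A : MKer (d + 1) (Fib d)) (x y : Fin (d + 1) → ℤ) (m : Fin (d + 1)) (f : Fib d) :
    comp (symEc N) A x y (Sum.inr m) f = if Torus.proj N x = 0 then A x y (Sum.inr m) f else 0 := by
  rw [comp_apply']
  have h : ∀ w, ∑ h : Fib d, symEc N x w (Sum.inr m) h * A w y h f =
      if w = x then (if Torus.proj N x = 0 then A w y (Sum.inr m) f else 0) else 0 := by
    intro w
    rw [Fintype.sum_sum_type]
    simp only [symEc_inr_inl, zero_mul, Finset.sum_const_zero, zero_add, symEc_inr_inr]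
    by_cases hw : w = x
    · subst hw
      rw [if_pos rfl, Finset.sum_eq_single m (fun μ _ hμ => by rw [if_neg (fun hh => hμ hh.2.1.symm), zero_mul])
        (fun hm => absurd (Finset.mem_univ m) hm)]
      by_cases hp : Torus.proj N w = 0
      · rw [if_pos ⟨rfl, rfl, hp⟩, if_pos hp, one_mul]
      · rw [if_neg (fun hh => hp hh.2.2), if_neg hp, zero_mul]
    · rw [if_neg hw]
      exact Finset.sum_eq_zero fun μ _ => by rw [if_neg (fun hh => hw hh.1.symm), zero_mul]
  simp_rw [h]
  exact tsum_point' x _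

/-- [folklore] **THE MULTIPLIER COLUMNS OF `symEc` ARE COARSE POINT MASSES**: `(A ∘ symEc N) y z f (inr m) = [proj N z = 0] · A y z f (inr m)`. -/
theorem comp_symEc_inr_col (A : MKer (d + 1) (Fib d)) (y z : Fin (d + 1) → ℤ) (f : Fib d) (m : Fin (d + 1)) :
    comp A (symEc N) y z f (Sum.inr m) = if Torus.proj N z = 0 then A y z f (Sum.inr m) else 0 := by
  rw [comp_apply']
  have h : ∀ w, ∑ h : Fib d, A y w f h * symEc N w z h (Sum.inr m) =
      if w = z then (if Torus.proj N z = 0 then A y w f (Sum.inr m) else 0) else 0 := by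
    intro w
    rw [Fintype.sum_sum_type]
    simp only [symEc_inl_inr, mul_zero, Finset.sum_const_zero, zero_add, symEc_inr_inr]
    by_cases hw : w = z
    · subst hw
      rw [if_pos rfl, Finset.sum_eq_single m (fun μ _ hμ => by rw [if_neg (fun hh => hμ hh.2.1), mul_zero])
        (fun hm => absurd (Finset.mem_univ m) hm)]
      by_cases hp : Torus.proj N w = 0
      · rw [if_pos ⟨rfl, rfl, hp⟩, if_pos hp, mul_one]
      · rw [if_neg (fun hh => hp hh.2.2), if_neg hp, mul_zero]
    · rw [if_neg hw]
      exact Finset.sum_eq_zero fun μ _ => by rw [if_neg (fun hh => hw hh.1), mul_zero]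
  simp_rw [h]
  exact tsum_point' z _

/-- [folklore] **A KERNEL FIXED BY `symEc` ON THE LEFT HAS COARSE MULTIPLIER ROWS**: `symEc ∘ K = K`, `proj N x ≠ 0` ⟹ `K x z (inr m) b = 0`. -/
theorem inr_row_coarse {K : MKer (d + 1) (Fib d)} (h : comp (symEc N) K = K) {x : Fin (d + 1) → ℤ} (hx : Torus.proj N x ≠ 0)
    (z : Fin (d + 1) → ℤ) (m : Fin (d + 1)) (b : Fib d) : K x z (Sum.inr m) b = 0 := by
  rw [← h, symEc_comp_inr_row, if_neg hx]

/-- [folklore] **A KERNEL FIXED BY `symEc` ON THE RIGHT HAS COARSE MULTIPLIER COLUMNS**: `K ∘ symEc = K`, `proj N z ≠ 0` ⟹ `K x z a (inr m) = 0`. -/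
theorem inr_col_coarse {K : MKer (d + 1) (Fib d)} (h : comp K (symEc N) = K) (x : Fin (d + 1) → ℤ) {z : Fin (d + 1) → ℤ}
    (hz : Torus.proj N z ≠ 0) (a : Fib d) (m : Fin (d + 1)) : K x z a (Sum.inr m) = 0 := by
  rw [← h, comp_symEc_inr_col, if_neg hz]

end Tools

/-! ## §2 The multiplier block of the sandwich from block facts — no commutation hypothesis -/

section Generic

variable {N : ℕ} {K M : MKer (d + 1) (Fib d)}

/-- [folklore] **THE RELATIVE-INVERSE SANDWICH OF A DIAGONAL COMMUTATOR CONTACT, MULTIPLIER BLOCK, FROM BLOCK FACTS.**  Let `K`, `M` be spread,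
`K` with coarse multiplier rows and columns, `(M∘K)_fm = 0`, `(K∘M)_mf = 0`, and `(M∘K)_mm = (K∘M)_mm` = the identity between coarse multiplier legs.
Then for every localised diagonal kernel `diagK g`,
`(K ∘ conjV M (diagK g) ∘ K) x z (inr m) (inr m′) = −conjV K (diagK g) x z (inr m) (inr m′)`
— the value `sandwich_conjV_rel` gives under `[E, diagK g] = 0`, here WITHOUT that hypothesis. -/
theorem mm_sandwich_conjV_diagK (hK : Spr K) (hM : Spr M) (g : (Fin (d + 1) → ℤ) → Fib d → ℝ) (hg : Loc (diagK g))
    (hKrow : ∀ (x z : Fin (d + 1) → ℤ) (m : Fin (d + 1)) (b : Fib d), Torus.proj N x ≠ 0 → K x z (Sum.inr m) b = 0)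
    (hKcol : ∀ (x z : Fin (d + 1) → ℤ) (a : Fib d) (m : Fin (d + 1)), Torus.proj N z ≠ 0 → K x z a (Sum.inr m) = 0)
    (hMKfm : ∀ (x z : Fin (d + 1) → ℤ) (a m : Fin (d + 1)), comp M K x z (Sum.inl a) (Sum.inr m) = 0)
    (hKMmf : ∀ (x z : Fin (d + 1) → ℤ) (m a : Fin (d + 1)), comp K M x z (Sum.inr m) (Sum.inl a) = 0)
    (hMKmm : ∀ (x z : Fin (d + 1) → ℤ) (m m' : Fin (d + 1)), Torus.proj N x = 0 → Torus.proj N z = 0 →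
      comp M K x z (Sum.inr m) (Sum.inr m') = if x = z ∧ m = m' then 1 else 0)
    (hKMmm : ∀ (x z : Fin (d + 1) → ℤ) (m m' : Fin (d + 1)), Torus.proj N x = 0 → Torus.proj N z = 0 →
      comp K M x z (Sum.inr m) (Sum.inr m') = if x = z ∧ m = m' then 1 else 0)
    (x z : Fin (d + 1) → ℤ) (m m' : Fin (d + 1)) :
    comp (comp K (conjV M (diagK g))) K x z (Sum.inr m) (Sum.inr m') = -(conjV K (diagK g) x z (Sum.inr m) (Sum.inr m')) := by
  have tK := hK.tame
  have tM := hM.tame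
  have tX := hg.tame
  have hMX : Loc (comp M (diagK g)) := hM.comp_loc hg
  have hXM : Loc (comp (diagK g) M) := hg.comp_spr hM
  have hKX : Loc (comp K (diagK g)) := hK.comp_loc hg
  have e : comp (comp K (conjV M (diagK g))) K =
      comp (comp (comp K M) (diagK g)) K - comp (comp K (diagK g)) (comp M K) := by
    unfold ChartConjugation.conjV
    rw [comp_sub_right_tame tK hMX.tame hXM.tame, comp_sub_left_tame (hK.comp_loc hMX).tame (hK.comp_loc hXM).tame tK,
      comp_assoc_tame tK tM tX, comp_assoc_tame tK tX tM, ← comp_assoc_tame hKX.tame tM tK]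
  rw [e, Pi.sub_apply, Pi.sub_apply, Pi.sub_apply, Pi.sub_apply]
  -- the two terms, entrywise
  have h1 : comp (comp (comp K M) (diagK g)) K x z (Sum.inr m) (Sum.inr m') = g x (Sum.inr m) * K x z (Sum.inr m) (Sum.inr m') := by
    rw [comp_apply']
    have hs : ∀ w, ∑ f, comp (comp K M) (diagK g) x w (Sum.inr m) f * K w z f (Sum.inr m') =
        if w = x then g x (Sum.inr m) * K x z (Sum.inr m) (Sum.inr m') else 0 := by
      intro w
      simp only [comp_diagK_right]
      rw [Fintype.sum_sum_type]
      simp only [hKMmf, zero_mul, Finset.sum_const_zero, zero_add]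
      by_cases hx : Torus.proj N x = 0
      · by_cases hw : Torus.proj N w = 0
        · simp only [hKMmm x w m _ hx hw]
          by_cases hxw : w = x
          · subst hxw
            rw [if_pos rfl, Finset.sum_eq_single m (fun μ _ hμ => by rw [if_neg (fun hh => hμ hh.2.symm), zero_mul, zero_mul])
              (fun hm => absurd (Finset.mem_univ m) hm), if_pos ⟨rfl, rfl⟩, one_mul]
          · rw [if_neg hxw]
            exact Finset.sum_eq_zero fun μ _ => by rw [if_neg (fun hh => hxw hh.1.symm), zero_mul, zero_mul]
        · have hxw : ¬ w = x := fun hh => hw (hh ▸ hx)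
          rw [if_neg hxw]
          exact Finset.sum_eq_zero fun μ _ => by rw [hKrow w z μ _ hw, mul_zero]
      · have hr : ∀ w' f, comp K M x w' (Sum.inr m) f = 0 := fun w' f => comp_row_eq_zero (fun y h => hKrow x y m h hx) w' f
        rw [hKrow x z m _ hx, mul_zero, ite_self]
        exact Finset.sum_eq_zero fun μ _ => by rw [hr, zero_mul, zero_mul]
    simp_rw [hs]
    exact tsum_point' x _
  have h2 : comp (comp K (diagK g)) (comp M K) x z (Sum.inr m) (Sum.inr m') = K x z (Sum.inr m) (Sum.inr m') * g z (Sum.inr m') := by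
    rw [comp_apply']
    have hs : ∀ w, ∑ f, comp K (diagK g) x w (Sum.inr m) f * comp M K w z f (Sum.inr m') =
        if w = z then K x z (Sum.inr m) (Sum.inr m') * g z (Sum.inr m') else 0 := by
      intro w
      simp only [comp_diagK_right]
      rw [Fintype.sum_sum_type]
      simp only [hMKfm, mul_zero, Finset.sum_const_zero, zero_add]
      by_cases hz : Torus.proj N z = 0
      · by_cases hw : Torus.proj N w = 0
        · simp only [hMKmm w z _ m' hw hz]
          by_cases hwz : w = z
          · subst hwz
            rw [if_pos rfl, Finset.sum_eq_single m' (fun μ _ hμ => by rw [if_neg (fun hh => hμ hh.2), mul_zero])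
              (fun hm => absurd (Finset.mem_univ m') hm), if_pos ⟨rfl, rfl⟩, mul_one]
          · rw [if_neg hwz]
            exact Finset.sum_eq_zero fun μ _ => by rw [if_neg (fun hh => hwz hh.1), mul_zero]
        · have hwz : ¬ w = z := fun hh => hw (hh ▸ hz)
          rw [if_neg hwz]
          exact Finset.sum_eq_zero fun μ _ => by rw [hKcol x w _ μ hw, zero_mul, zero_mul]
      · have hc : ∀ w' f, comp M K w' z f (Sum.inr m') = 0 := fun w' f => comp_col_eq_zero (fun y h => hKcol y z h m' hz) w' f
        rw [hKcol x z _ m' hz, zero_mul, ite_self]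
        exact Finset.sum_eq_zero fun μ _ => by rw [hc, mul_zero]
    simp_rw [hs]
    exact tsum_point' z _
  rw [h1, h2, conjV_diagK_apply]
  ring

end Generic

/-! ## §3 The literal's symmetrised step resolvents against the straight spread -/

section Straight

variable {Lc : ℕ} [NeZero Lc]

/-- [folklore] `G_j` is spread (`SymmetrisedStepJets.decays_Gsym`). -/
theorem spr_Gsym (j : ℕ) : Spr (Gsym (d := d) Lc j) := by
  obtain ⟨δ, C, hδ, -, h⟩ := decays_Gsym (d := d) Lc j
  exact ⟨C, δ, hδ, h⟩

/-- [folklore] Rules 1–2 on the literal's name: `symEc ∘ G_j = G_j` and `G_j ∘ symEc = G_j`. -/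
theorem symEc_rules_Gsym (j : ℕ) : comp (symEc Lc) (Gsym (d := d) Lc j) = Gsym Lc j ∧ comp (Gsym (d := d) Lc j) (symEc Lc) = Gsym Lc j := by
  rw [Gsym_apply]; exact symEc_rules_coDressKSymAt_KInvStep j

/-- [folklore] `G_j` has coarse multiplier rows. -/
theorem Gsym_inr_row_coarse (j : ℕ) (x z : Fin (d + 1) → ℤ) (m : Fin (d + 1)) (b : Fib d) (hx : Torus.proj Lc x ≠ 0) :
    Gsym (d := d) Lc j x z (Sum.inr m) b = 0 :=
  inr_row_coarse (symEc_rules_Gsym j).1 hx z m b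

/-- [folklore] `G_j` has coarse multiplier columns. -/
theorem Gsym_inr_col_coarse (j : ℕ) (x z : Fin (d + 1) → ℤ) (a : Fib d) (m : Fin (d + 1)) (hz : Torus.proj Lc z ≠ 0) :
    Gsym (d := d) Lc j x z a (Sum.inr m) = 0 :=
  inr_col_coarse (symEc_rules_Gsym j).2 x hz a m

/-- [folklore] **THE FACTORISATION, EVERY LEVEL**: `bhKStep d Lc j ∘ G_j = piKSymBmC ρ_c Lc` (`j = 0`: K2-e; `j + 1`: K3-b's step). -/
theorem comp_bhKStep_Gsym : ∀ j : ℕ, comp (bhKStep d Lc j) (Gsym (d := d) Lc j) = piKSymBmC (ctr (d + 1) Lc) Lc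
  | 0 => by rw [Gsym_apply, bhKStep_zero, KInvStep_zero_eq]; exact comp_bhK_coDressKSymAt_KInv
  | j + 1 => by rw [Gsym_apply]; exact comp_bhKStep_coDressKSymAt j

/-- [folklore] **THE TRANSPOSED FACTORISATION, EVERY LEVEL**: `G_j ∘ bhKStep d Lc j = trK (piKSymBmC ρ_c Lc)`. -/
theorem comp_Gsym_bhKStep : ∀ j : ℕ, comp (Gsym (d := d) Lc j) (bhKStep d Lc j) = trK (piKSymBmC (ctr (d + 1) Lc) Lc)
  | 0 => by rw [Gsym_apply, bhKStep_zero, KInvStep_zero_eq]; exact comp_coDressKSymAt_KInv_bhK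
  | j + 1 => by rw [Gsym_apply]; exact comp_coDressKSymAt_bhKStep j

/-- [folklore] `(bhKStep j ∘ G_j)_fm = 0`. -/
theorem comp_bhKStep_Gsym_inl_inr (j : ℕ) (x z : Fin (d + 1) → ℤ) (a m : Fin (d + 1)) :
    comp (bhKStep d Lc j) (Gsym (d := d) Lc j) x z (Sum.inl a) (Sum.inr m) = 0 := by
  rw [comp_bhKStep_Gsym, piKSymBmC_inl_inr]

/-- [folklore] `(G_j ∘ bhKStep j)_mf = 0`. -/
theorem comp_Gsym_bhKStep_inr_inl (j : ℕ) (x z : Fin (d + 1) → ℤ) (m a : Fin (d + 1)) :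
    comp (Gsym (d := d) Lc j) (bhKStep d Lc j) x z (Sum.inr m) (Sum.inl a) = 0 := by
  rw [comp_Gsym_bhKStep, trK_apply, piKSymBmC_inl_inr]

/-- [folklore] `(bhKStep j ∘ G_j)_mm` is the identity between coarse multiplier legs. -/
theorem comp_bhKStep_Gsym_inr_inr (j : ℕ) (x z : Fin (d + 1) → ℤ) (m m' : Fin (d + 1)) (hx : Torus.proj Lc x = 0) :
    comp (bhKStep d Lc j) (Gsym (d := d) Lc j) x z (Sum.inr m) (Sum.inr m') = if x = z ∧ m = m' then 1 else 0 := by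
  rw [comp_bhKStep_Gsym, piKSymBmC_inr_inr]
  by_cases h : x = z ∧ m = m'
  · rw [if_pos ⟨h.1, h.2, hx⟩, if_pos h]
  · rw [if_neg (fun hh => h ⟨hh.1, hh.2.1⟩), if_neg h]

/-- [folklore] `(G_j ∘ bhKStep j)_mm` is the identity between coarse multiplier legs. -/
theorem comp_Gsym_bhKStep_inr_inr (j : ℕ) (x z : Fin (d + 1) → ℤ) (m m' : Fin (d + 1)) (hz : Torus.proj Lc z = 0) :
    comp (Gsym (d := d) Lc j) (bhKStep d Lc j) x z (Sum.inr m) (Sum.inr m') = if x = z ∧ m = m' then 1 else 0 := by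
  rw [comp_Gsym_bhKStep, trK_apply, piKSymBmC_inr_inr]
  by_cases h : x = z ∧ m = m'
  · rw [if_pos ⟨h.1.symm, h.2.symm, hz⟩, if_pos h]
  · rw [if_neg (fun hh => h ⟨hh.1.symm, hh.2.1.symm⟩), if_neg h]

/-- [folklore] **THE SANDWICH AGAINST THE STRAIGHT SPREAD, MULTIPLIER BLOCK** (chart (II), no commutation hypothesis): for every `j` and every
localised diagonal `diagK g`, `(G_j ∘ conjV (bhKStep d Lc j) (diagK g) ∘ G_j) x z (inr m) (inr m′) = −conjV G_j (diagK g) x z (inr m) (inr m′)`. -/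
theorem mm_sandwich_Gsym_bhKStep (j : ℕ) (g : (Fin (d + 1) → ℤ) → Fib d → ℝ) (hg : Loc (diagK g)) (x z : Fin (d + 1) → ℤ)
    (m m' : Fin (d + 1)) :
    comp (comp (Gsym Lc j) (conjV (bhKStep d Lc j) (diagK g))) (Gsym Lc j) x z (Sum.inr m) (Sum.inr m') =
      -(conjV (Gsym (d := d) Lc j) (diagK g) x z (Sum.inr m) (Sum.inr m')) :=
  mm_sandwich_conjV_diagK (spr_Gsym j) (spr_bhKStep j) g hg (fun x z m b hx => Gsym_inr_row_coarse j x z m b hx)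
    (fun x z a m hz => Gsym_inr_col_coarse j x z a m hz) (comp_bhKStep_Gsym_inl_inr j) (comp_Gsym_bhKStep_inr_inl j)
    (fun x z m m' hx _ => comp_bhKStep_Gsym_inr_inr j x z m m' hx) (fun x z m m' _ hz => comp_Gsym_bhKStep_inr_inr j x z m m' hz) x z m m'

end Straight

/-! ## §4 The literal's symmetrised step resolvents against the SHIFTED spread `bhKStepSh Dsh j` -/

section Shifted

variable {Lc : ℕ} [NeZero Lc] {Dsh : MKer (d + 1) (Fib d)}

/-- [folklore] **(Dnull) ⟹ THE SHIFT IS INVISIBLE ON COARSE MULTIPLIER ROWS THROUGH `G_j`**: `symEc∘Dsh∘symEc = 0`, `proj Lc x = 0` ⟹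
`(Dsh ∘ G_j) x z (inr m) b = 0` (rule 1 `symEc ∘ G_j = G_j`; the multiplier rows of `symEc` are coarse point masses). -/
theorem comp_Dsh_Gsym_inr_of_null (hD : Spr Dsh) (hDnull : comp (comp (symEc Lc) Dsh) (symEc Lc) = 0) (j : ℕ)
    {x : Fin (d + 1) → ℤ} (hx : Torus.proj Lc x = 0) (z : Fin (d + 1) → ℤ) (m : Fin (d + 1)) (b : Fib d) :
    comp Dsh (Gsym (d := d) Lc j) x z (Sum.inr m) b = 0 := by
  have hLc : 1 ≤ Lc := one_le_of_neZero Lc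
  have sE : Spr (symEc (d := d) Lc) := spr_symEc hLc
  have hrow : ∀ y f, comp Dsh (symEc Lc) x y (Sum.inr m) f = 0 := by
    intro y f
    have h0 : comp (symEc Lc) (comp Dsh (symEc Lc)) x y (Sum.inr m) f = 0 := by
      rw [comp_assoc_tame sE.tame hD.tame sE.tame, hDnull]; rfl
    rw [symEc_comp_inr_row, if_pos hx] at h0
    exact h0
  rw [← (symEc_rules_Gsym (d := d) (Lc := Lc) j).1, comp_assoc_tame hD.tame sE.tame (spr_Gsym j).tame]
  exact comp_row_eq_zero hrow z b

/-- [folklore] **(Dnull) ⟹ THE SHIFT IS INVISIBLE ON COARSE MULTIPLIER COLUMNS THROUGH `G_j`**: `proj Lc z = 0` ⟹ `(G_j ∘ Dsh) x z a (inr m) = 0`. -/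
theorem comp_Gsym_Dsh_inr_of_null (hD : Spr Dsh) (hDnull : comp (comp (symEc Lc) Dsh) (symEc Lc) = 0) (j : ℕ) (x : Fin (d + 1) → ℤ)
    {z : Fin (d + 1) → ℤ} (hz : Torus.proj Lc z = 0) (a : Fib d) (m : Fin (d + 1)) :
    comp (Gsym (d := d) Lc j) Dsh x z a (Sum.inr m) = 0 := by
  have hLc : 1 ≤ Lc := one_le_of_neZero Lc
  have sE : Spr (symEc (d := d) Lc) := spr_symEc hLc
  have hcol : ∀ y f, comp (symEc Lc) Dsh y z f (Sum.inr m) = 0 := by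
    intro y f
    have h0 : comp (comp (symEc Lc) Dsh) (symEc Lc) y z f (Sum.inr m) = 0 := by rw [hDnull]; rfl
    rw [comp_symEc_inr_col, if_pos hz] at h0
    exact h0
  rw [← (symEc_rules_Gsym (d := d) (Lc := Lc) j).2, ← comp_assoc_tame (spr_Gsym j).tame sE.tame hD.tame]
  exact comp_col_eq_zero hcol x a

/-- [folklore] `bhKStepSh Dsh j ∘ G_j = bhKStep j ∘ G_j + stepScale j • (Dsh ∘ G_j)`, entrywise. -/
theorem comp_bhKStepSh_Gsym_apply (hD : Spr Dsh) (j : ℕ) (x z : Fin (d + 1) → ℤ) (a b : Fib d) :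
    comp (bhKStepSh d Lc Dsh j) (Gsym (d := d) Lc j) x z a b =
      comp (bhKStep d Lc j) (Gsym Lc j) x z a b + stepScale d Lc j * comp Dsh (Gsym Lc j) x z a b := by
  rw [bhKStepSh_apply, comp_add_left_tame (spr_bhKStep j).tame (spr_smul _ hD).tame (spr_Gsym j).tame, KernelReflection.comp_smul_left]
  rfl

/-- [folklore] `G_j ∘ bhKStepSh Dsh j = G_j ∘ bhKStep j + stepScale j • (G_j ∘ Dsh)`, entrywise. -/
theorem comp_Gsym_bhKStepSh_apply (hD : Spr Dsh) (j : ℕ) (x z : Fin (d + 1) → ℤ) (a b : Fib d) :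
    comp (Gsym (d := d) Lc j) (bhKStepSh d Lc Dsh j) x z a b =
      comp (Gsym Lc j) (bhKStep d Lc j) x z a b + stepScale d Lc j * comp (Gsym Lc j) Dsh x z a b := by
  rw [bhKStepSh_apply, comp_add_right_tame (spr_Gsym j).tame (spr_bhKStep j).tame (spr_smul _ hD).tame, KernelReflection.comp_smul_right]
  rfl

/-- [folklore] `(bhKStepSh Dsh j ∘ G_j)_fm = 0` under (DG)'s second half. -/
theorem comp_bhKStepSh_Gsym_inl_inr (hD : Spr Dsh) (j : ℕ)
    (hDG : ∀ (x z : Fin (d + 1) → ℤ) (a m : Fin (d + 1)), comp Dsh (Gsym (d := d) Lc j) x z (Sum.inl a) (Sum.inr m) = 0)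
    (x z : Fin (d + 1) → ℤ) (a m : Fin (d + 1)) : comp (bhKStepSh d Lc Dsh j) (Gsym (d := d) Lc j) x z (Sum.inl a) (Sum.inr m) = 0 := by
  rw [comp_bhKStepSh_Gsym_apply hD, comp_bhKStep_Gsym_inl_inr, hDG, mul_zero, add_zero]

/-- [folklore] `(G_j ∘ bhKStepSh Dsh j)_mf = 0` under (DG)'s first half. -/
theorem comp_Gsym_bhKStepSh_inr_inl (hD : Spr Dsh) (j : ℕ)
    (hGD : ∀ (x z : Fin (d + 1) → ℤ) (m a : Fin (d + 1)), comp (Gsym (d := d) Lc j) Dsh x z (Sum.inr m) (Sum.inl a) = 0)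
    (x z : Fin (d + 1) → ℤ) (m a : Fin (d + 1)) : comp (Gsym (d := d) Lc j) (bhKStepSh d Lc Dsh j) x z (Sum.inr m) (Sum.inl a) = 0 := by
  rw [comp_Gsym_bhKStepSh_apply hD, comp_Gsym_bhKStep_inr_inl, hGD, mul_zero, add_zero]

/-- [folklore] `(bhKStepSh Dsh j ∘ G_j)_mm` is the identity between coarse multiplier legs, under (Dnull). -/
theorem comp_bhKStepSh_Gsym_inr_inr (hD : Spr Dsh) (hDnull : comp (comp (symEc Lc) Dsh) (symEc Lc) = 0) (j : ℕ)
    (x z : Fin (d + 1) → ℤ) (m m' : Fin (d + 1)) (hx : Torus.proj Lc x = 0) :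
    comp (bhKStepSh d Lc Dsh j) (Gsym (d := d) Lc j) x z (Sum.inr m) (Sum.inr m') = if x = z ∧ m = m' then 1 else 0 := by
  rw [comp_bhKStepSh_Gsym_apply hD, comp_bhKStep_Gsym_inr_inr j x z m m' hx, comp_Dsh_Gsym_inr_of_null hD hDnull j hx, mul_zero, add_zero]

/-- [folklore] `(G_j ∘ bhKStepSh Dsh j)_mm` is the identity between coarse multiplier legs, under (Dnull). -/
theorem comp_Gsym_bhKStepSh_inr_inr (hD : Spr Dsh) (hDnull : comp (comp (symEc Lc) Dsh) (symEc Lc) = 0) (j : ℕ)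
    (x z : Fin (d + 1) → ℤ) (m m' : Fin (d + 1)) (hz : Torus.proj Lc z = 0) :
    comp (Gsym (d := d) Lc j) (bhKStepSh d Lc Dsh j) x z (Sum.inr m) (Sum.inr m') = if x = z ∧ m = m' then 1 else 0 := by
  rw [comp_Gsym_bhKStepSh_apply hD, comp_Gsym_bhKStep_inr_inr j x z m m' hz, comp_Gsym_Dsh_inr_of_null hD hDnull j x hz, mul_zero, add_zero]

/-- [folklore] **THE SANDWICH AGAINST THE SHIFTED SPREAD OF RECORD, MULTIPLIER BLOCK** (RULING R-D1-g28-2 (F)+(S)): under (Dspr) `Spr Dsh`,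
(Dnull) `symEc∘Dsh∘symEc = 0` and (DG) `(G_j∘Dsh)_mf = 0 ∧ (Dsh∘G_j)_fm = 0`, for every localised diagonal `diagK g`,
`(G_j ∘ conjV (bhKStepSh d Lc Dsh j) (diagK g) ∘ G_j) x z (inr m) (inr m′) = −conjV G_j (diagK g) x z (inr m) (inr m′)`. -/
theorem mm_sandwich_Gsym_bhKStepSh (hD : Spr Dsh) (hDnull : comp (comp (symEc Lc) Dsh) (symEc Lc) = 0) (j : ℕ)
    (hGD : ∀ (x z : Fin (d + 1) → ℤ) (m a : Fin (d + 1)), comp (Gsym (d := d) Lc j) Dsh x z (Sum.inr m) (Sum.inl a) = 0)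
    (hDG : ∀ (x z : Fin (d + 1) → ℤ) (a m : Fin (d + 1)), comp Dsh (Gsym (d := d) Lc j) x z (Sum.inl a) (Sum.inr m) = 0)
    (g : (Fin (d + 1) → ℤ) → Fib d → ℝ) (hg : Loc (diagK g)) (x z : Fin (d + 1) → ℤ) (m m' : Fin (d + 1)) :
    comp (comp (Gsym Lc j) (conjV (bhKStepSh d Lc Dsh j) (diagK g))) (Gsym Lc j) x z (Sum.inr m) (Sum.inr m') =
      -(conjV (Gsym (d := d) Lc j) (diagK g) x z (Sum.inr m) (Sum.inr m')) :=
  mm_sandwich_conjV_diagK (spr_Gsym j) (spr_bhKStepSh hD j) g hg (fun x z m b hx => Gsym_inr_row_coarse j x z m b hx)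
    (fun x z a m hz => Gsym_inr_col_coarse j x z a m hz) (comp_bhKStepSh_Gsym_inl_inr hD j hDG) (comp_Gsym_bhKStepSh_inr_inl hD j hGD)
    (fun x z m m' hx _ => comp_bhKStepSh_Gsym_inr_inr hD hDnull j x z m m' hx)
    (fun x z m m' _ hz => comp_Gsym_bhKStepSh_inr_inr hD hDnull j x z m m' hz) x z m m'

end Shifted

end Summit.QuantumFields.BalabanUV.Beta.RelInvFactorSandwich

end
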